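import Literature.NumberTheory.EllipticCurves.BigGaloisRepSelmer
import Literature.NumberTheory.GaloisRepresentations.ContinuousRepCoeffExtension
import Literature.NumberTheory.EllipticCurves.PrimaryTorsionGaloisRep
import Literature.NumberTheory.GaloisRepresentations.ContinuousH1CoefficientTransport
import Literature.NumberTheory.EllipticCurves.BigRepModuleCoeffExtension
import Literature.LinearAlgebra.BaseChange.FreeFiniteBaseChangeOfCoordinates
import Literature.RingTheory.PowerSeries.FiniteFreeCoefficients
import HarnessLib

/-!
# Skinner 2016, §2.3: Selmer groups of `T ⊗ Λ_𝒪^*` commute with a finite extension of the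
# coefficient ring — `Sel(T ⊗_𝒪 𝒪₁) ≅ Sel(T) ⊗_𝒪 𝒪₁` as `Λ_{𝒪₁} = Λ_𝒪 ⊗_𝒪 𝒪₁`-modules (named fact
# (SelBC) of the Road FF, in `BigGaloisRepSelmer` currency)

Cell `bsd-stepL` (run/shared/lean/pub/bsd-stepL/), typer lane `bsd-stepL-defn-ty1` (g3), for the deciding
stub `stub_roadFF_fittingCongruenceFrameB` of crux `stmt-BirchSwinnertonDyer-20169` (`IMCDivAtErratumDataAllR`):
imc-p1 g9's residual **(SelBC)** of the binder `e_m` (HOME/imc-p1/g9/STUB2-RESIDUAL-20169-imc-p1-g9.md) —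
the one input of the coefficient base change `X^Σ_{𝒪_m}(E[p^∞] ⊗ 𝒪_m) ≅ 𝒪_m⟦T⟧ ⊗_Λ X^Σ(E[p^∞])` that is
not kernel algebra (`Theorems/ErratumRoadFiveCoeffBaseChangeCharacterModule.lean` does the Pontryagin-dual
half from Frobenius data, supplied by `PadicCoeffIntegersFrobeniusData.lean`). ONE named fact (a published
observation, stated on the tree's objects); no `sorry`, no definition, no instance.

## Source, verbatim

C. Skinner, *Multiplicative reduction and the cyclotomic main conjecture for GL₂*, Pacific J. Math. 283
(2016) 171–200, §2.3 "Iwasawa–Greenberg Selmer groups" (p. 179; arXiv:1407.1093, held text chunk p0007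
L9–L34): "Put `𝓜 = T_f ⊗_𝒪 Λ_𝒪^*`, with `G_ℚ`-action given by `ρ_f ⊗ Ψ⁻¹`. … we define a Selmer group
`Sel^Σ_{ℚ_∞,L}(f) = ker{H¹(G_S, 𝓜) → H¹(I_p, 𝓜⁻)^{G_{ℚ_p}} × ∏_{ℓ ∈ S∖Σ} H¹(I_ℓ, 𝓜)^{G_{ℚ_ℓ}}}`. This is a
discrete, cofinite `Λ_𝒪`-module. … **Furthermore, if `L₁ ⊃ L` is a finite extension with ring of integers
`𝒪₁ ⊃ 𝒪`, then `T_{f,1} = T_f ⊗_𝒪 𝒪₁` is a `G_ℚ`-stable `𝒪₁`-lattice in `V₁ = V_f ⊗_L L₁` and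
`T⁺_{f,1} = T⁺_f ⊗_𝒪 𝒪₁`. Hence the Selmer group `Sel^Σ_{ℚ_∞,L₁}(f)`, defined with respect to the lattice
`T_{f,1}`, is canonically isomorphic to `Sel^Σ_{ℚ_∞,L}(f) ⊗_𝒪 𝒪₁` as a `Λ_{𝒪₁} = Λ_𝒪 ⊗_𝒪 𝒪₁`-module,
from which it follows that its Pontryagin dual `X^Σ_{ℚ_∞,L₁}(f)` is isomorphic to `X^Σ_{ℚ_∞,L} ⊗_𝒪 𝒪₁` as
a `Λ_{𝒪₁}`-module and therefore `Ch^Σ_{L₁}(f) = Ch^Σ_L(f)·Λ_{𝒪₁}`.**" (Used this way in [Castella2018Erratum],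
proof of Thm. 1.1 (p. 4): "after possibly enlarging `𝒪`"; and [EmertonPollackWeston2006] §5.1 (p. 30): the
main conjecture "is independent of the particular choice of coefficient field `K` over which `f` is
defined".)

## Transcription (tree vocabulary only; nothing re-declared)

The tree's model of `T ⊗_𝒪 Λ_𝒪^*(Ψ⁻¹)` over a number field `K` with a `ℤ_p`-extension `κ` is the co-induced
module `AnticyclotomicBigGaloisRep κ ρ` of a continuous `𝒪`-linear `ρ` on a DISCRETE `𝒪`-module `A`
(`A = T ⊗ Frac 𝒪/𝒪`; file `AnticyclotomicBigGaloisRep.lean`), its `Σ`-imprimitive Selmer group with the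
local conditions of [Castella2018Erratum] §2 / [Castella2018] Def. 2.2 is
`BigGaloisRep.selmerBig κ ρ 𝔮 Σ`, a `Λ_𝒪 = PowerSeries 𝒪`-submodule of `H¹(Γ_K, M)` (file
`BigGaloisRepSelmer.lean`), and the coefficient extension `T ⊗_𝒪 𝒪₁` read on discrete modules is
`ρ.extendScalars 𝒪₁` on `CoeffExtension 𝒪 𝒪₁ A = 𝒪₁ ⊗_𝒪 A` (file `ContinuousRepCoeffExtension.lean`).
Skinner's "canonically isomorphic to `Sel ⊗_𝒪 𝒪₁` as a `Λ_{𝒪₁} = Λ_𝒪 ⊗_𝒪 𝒪₁`-module" is typed as a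
`PowerSeries 𝒪₁`-linear isomorphism with `PowerSeries 𝒪₁ ⊗[PowerSeries 𝒪] (selmerBig κ ρ 𝔮 Σ)`
(`Λ_{𝒪₁} ⊗_{Λ_𝒪} Sel = (Λ_𝒪 ⊗_𝒪 𝒪₁) ⊗_{Λ_𝒪} Sel = Sel ⊗_𝒪 𝒪₁`; Mathlib's `PowerSeries.algebraPowerSeries`
for `Λ_𝒪 → Λ_{𝒪₁}`), for `𝒪₁` FREE OF FINITE RANK over `𝒪` ("`𝒪₁ ⊃ 𝒪` the ring of integers of a finite
extension"), and — as in the tree's other facts on these objects (`SkinnerUrban2014.prop323_XAc_equiv_XBigDecomp`)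
— for every topology on the coefficient rings making the actions continuous (the groups do not depend on it).
WHY IT HOLDS (the printed "Hence"): an `𝒪`-basis `𝒪₁ ≅ 𝒪^d` gives `𝒪₁ ⊗ A ≅ A^d` and `M(𝒪₁ ⊗ A) ≅ M(A)^d`
equivariantly, continuous `H¹` and the local restriction maps are additive, so `Sel(M(𝒪₁ ⊗ A)) ≅ Sel(M(A))^d ≅
𝒪₁ ⊗_𝒪 Sel(M(A))`, `𝒪₁`-linearly because multiplication by `c ∈ 𝒪₁` is an `𝒪`-matrix on the basis.
(Kernel road, for a later discharge: the tree's crossed-homomorphism presentation `oneCocycleClass`,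
`oneCocycleClass_surjective`, `oneCocycleClass_eq_zero_iff`, `map_oneCocycleClass` of
`GaloisRepresentations/ContinuousH1.lean` compares `H¹` across the two scalar rings elementwise.)

## Flags (nothing hidden)

* `SelBC-setting`: print's sentence is for the CYCLOTOMIC Greenberg Selmer group of a modular form over `ℚ`
  (ordinary condition at `p`, unramified outside `Σ`); the fact states the same base-change property for the
  tree's ANTICYCLOTOMIC `Σ`-imprimitive Selmer groups `selmerBig` over a number field `K` (strict at `𝔮`,
  unramified at the finite `w ∉ Σ`, `w ∤ p`, relaxed elsewhere) and for ANY discrete `𝒪`-linear `ρ` — the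
  printed justification ("`T_{f,1} = T_f ⊗_𝒪 𝒪₁` … Hence …") is local-condition-wise and does not use the
  shape of the conditions; [Castella2018Erratum] p. 4 "after possibly enlarging `𝒪`" uses it in exactly
  this anticyclotomic setting.
* `SelBC-free`: "`L₁ ⊃ L` finite, `𝒪₁` its ring of integers" is typed as `Module.Free 𝒪 𝒪₁` +
  `Module.Finite 𝒪 𝒪₁` (for `𝒪 = ℤ_p`, `𝒪₁ = padicCoeffIntegers ι`: tree theorems
  `GreenbergSelmer.moduleFree_padicCoeffIntegers` / `moduleFinite_padicCoeffIntegers`).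

## References

* [Skinner2016PacificMC] C. Skinner, Pacific J. Math. 283 (2016), §2.3 (p. 179), the paragraph
  "Furthermore, if `L₁ ⊃ L` …" and its display `Ch^Σ_{L₁}(f) = Ch^Σ_L(f)·Λ_{𝒪₁}`.
* [Castella2018Erratum] proof of Thm. 1.1 (p. 4, "after possibly enlarging `𝒪`"); §2 (p. 2, `M_g = T_g ⊗_𝒪 Λ_𝒪^*`).
* [EmertonPollackWeston2006] §5.1 (p. 30).
* Tree: `BigGaloisRepSelmer.lean` (`selmerBig`, `XBig`), `ContinuousRepCoeffExtension.lean`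
  (`CoeffExtension`, `ContinuousRep.extendScalars`; its module docstring's `TODO(general form)` is THIS fact),
  `PadicCoeffIntegersFrobeniusData.lean`, Summits consumer `Theorems/ErratumRoadFiveCoeffBaseChangeCharacterModule.lean`.
-/

noncomputable section

open scoped TensorProduct
open Field IsDedekindDomain NumberField
open Literature.NumberTheory.GaloisRepresentations Literature.NumberTheory.EllipticCurves.BigGaloisRep

universe v

namespace Literature.NumberTheory.EllipticCurves.Skinner2016

/-- **Skinner 2016, §2.3 (coefficient base change of `Λ`-adic Selmer groups), in the tree's anticyclotomic
`Σ`-imprimitive currency:** for a number field `K`, a prime `p`, a `ℤ_p`-extension `κ` of `K`, a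
continuous `𝒪`-linear representation `ρ` of `Γ_K` on a discrete `𝒪`-module `A`, a strict prime `𝔮`, a set
`Σ` of finite places, and a commutative `𝒪`-algebra `𝒪₁` that is FREE OF FINITE RANK as an `𝒪`-module,
the Selmer group of the big representation of the coefficient-extended `ρ ⊗_𝒪 𝒪₁`
(`ρ.extendScalars 𝒪₁` on `𝒪₁ ⊗_𝒪 A`) is isomorphic, `Λ_{𝒪₁} = 𝒪₁⟦T⟧`-linearly, to
`Λ_{𝒪₁} ⊗_{Λ_𝒪} Sel^Σ_𝔮(K, M(ρ))` ("`Sel^Σ_{L₁}(f)`, defined with respect to the lattice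
`T_{f,1} = T_f ⊗_𝒪 𝒪₁`, is canonically isomorphic to `Sel^Σ_L(f) ⊗_𝒪 𝒪₁` as a
`Λ_{𝒪₁} = Λ_𝒪 ⊗_𝒪 𝒪₁`-module"). Stated for every topology on `Λ_𝒪`, `Λ_{𝒪₁}` making the actions
continuous. Flags `SelBC-setting`, `SelBC-free` (module docstring). A named fact (D-0014); NEVER cite it
as a theorem of the tree.
[cite: Skinner2016PacificMC, §2.3 (p. 179), "Furthermore, if `L₁ ⊃ L` is a finite extension … canonically isomorphic to `Sel^Σ_{ℚ_∞,L}(f) ⊗_𝒪 𝒪₁` as a `Λ_{𝒪₁} = Λ_𝒪 ⊗_𝒪 𝒪₁`-module" (arXiv:1407.1093 chunk p0007 L27–34)]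
[cite: Castella2018Erratum, proof of Thm. 1.1 (p. 4, "after possibly enlarging `𝒪`")] -/
def selmerBig_extendScalars_equiv_baseChange : Prop :=
  ∀ {K : Type} [Field K] [NumberField K] {p : ℕ} [Fact p.Prime] (κ : ZpExtension K p)
    {𝒪 : Type} [CommRing 𝒪] [TopologicalSpace 𝒪]
    {A : Type} [AddCommGroup A] [Module 𝒪 A] [TopologicalSpace A] [DiscreteTopology A]
    (ρ : ContinuousRep (absoluteGaloisGroup K) 𝒪 A)
    (𝒪₁ : Type) [CommRing 𝒪₁] [Algebra 𝒪 𝒪₁] [TopologicalSpace 𝒪₁] [Module.Free 𝒪 𝒪₁]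
    [Module.Finite 𝒪 𝒪₁]
    (𝔮 : HeightOneSpectrum (𝓞 K)) (S : Set (HeightOneSpectrum (𝓞 K)))
    [TopologicalSpace (PowerSeries 𝒪)] [ContinuousSMul (PowerSeries 𝒪) (BigRepModule 𝒪 p A)]
    [TopologicalSpace (PowerSeries 𝒪₁)]
    [ContinuousSMul (PowerSeries 𝒪₁) (BigRepModule 𝒪₁ p (CoeffExtension 𝒪 𝒪₁ A))],
    Nonempty
      (selmerBig κ (ρ.extendScalars 𝒪₁) 𝔮 S ≃ₗ[PowerSeries 𝒪₁]
        PowerSeries 𝒪₁ ⊗[PowerSeries 𝒪] selmerBig κ ρ 𝔮 S)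

/-! ### Proved corollaries: the shapes consumed downstream -/

section Corollaries

variable {K : Type} [Field K] [NumberField K] {p : ℕ} [Fact p.Prime] (κ : ZpExtension K p)
  {𝒪 : Type} [CommRing 𝒪] [TopologicalSpace 𝒪]
  {A : Type} [AddCommGroup A] [Module 𝒪 A] [TopologicalSpace A] [DiscreteTopology A]
  (ρ : ContinuousRep (absoluteGaloisGroup K) 𝒪 A)
  (𝒪₁ : Type) [CommRing 𝒪₁] [Algebra 𝒪 𝒪₁] [TopologicalSpace 𝒪₁] [Module.Free 𝒪 𝒪₁] [Module.Finite 𝒪 𝒪₁]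
  (𝔮 : HeightOneSpectrum (𝓞 K)) (S : Set (HeightOneSpectrum (𝓞 K)))
  [TopologicalSpace (PowerSeries 𝒪)] [ContinuousSMul (PowerSeries 𝒪) (BigRepModule 𝒪 p A)]
  [TopologicalSpace (PowerSeries 𝒪₁)]
  [ContinuousSMul (PowerSeries 𝒪₁) (BigRepModule 𝒪₁ p (CoeffExtension 𝒪 𝒪₁ A))]

/-- **Pontryagin-dual form: `X^Σ(ρ ⊗ 𝒪₁) ≅ (Λ_{𝒪₁} ⊗_{Λ_𝒪} Sel^Σ(ρ))^∨`** (`CharacterModule.congr` along the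
fact's isomorphism) — the input of the Road-FF consumer, which continues with
`CoeffBaseChange.nonempty_characterModule_powerSeries_baseChange_equiv` ("`X^Σ_{L₁} ≅ X^Σ_L ⊗_𝒪 𝒪₁`").
[cite: Skinner2016PacificMC, §2.3 (p. 179), "its Pontryagin dual `X^Σ_{ℚ_∞,L₁}(f)` is isomorphic to `X^Σ_{ℚ_∞,L} ⊗_𝒪 𝒪₁` as a `Λ_{𝒪₁}`-module"] -/
theorem nonempty_XBig_extendScalars_equiv (h : selmerBig_extendScalars_equiv_baseChange) :
    Nonempty
      (XBig κ (ρ.extendScalars 𝒪₁) 𝔮 S ≃ₗ[PowerSeries 𝒪₁]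
        CharacterModule (PowerSeries 𝒪₁ ⊗[PowerSeries 𝒪] selmerBig κ ρ 𝔮 S)) := by
  obtain ⟨e⟩ := h κ ρ 𝒪₁ 𝔮 S
  exact ⟨CharacterModule.congr (R := PowerSeries 𝒪₁) e⟩

end Corollaries

section Curve

variable (W : WeierstrassCurve ℚ) {K : Type} [Field K] [NumberField K] {p : ℕ} [Fact p.Prime]
  (κ : ZpExtension K p) (𝒪₁ : Type) [CommRing 𝒪₁] [Algebra ℤ_[p] 𝒪₁] [TopologicalSpace 𝒪₁]
  [Module.Free ℤ_[p] 𝒪₁] [Module.Finite ℤ_[p] 𝒪₁]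
  (𝔮 : HeightOneSpectrum (𝓞 K)) (S : Set (HeightOneSpectrum (𝓞 K)))
  [TopologicalSpace (IwasawaAlgebra p)]
  [ContinuousSMul (IwasawaAlgebra p)
    (BigRepModule ℤ_[p] p (PrimaryTorsion (WeierstrassCurve.geomPoints (W.baseChange K)) p))]
  [TopologicalSpace (PowerSeries 𝒪₁)]
  [ContinuousSMul (PowerSeries 𝒪₁)
    (BigRepModule 𝒪₁ p
      (CoeffExtension ℤ_[p] 𝒪₁ (PrimaryTorsion (WeierstrassCurve.geomPoints (W.baseChange K)) p)))]

/-- **The `E`-instance (`𝒪 = ℤ_p`, `A = E[p^∞]` over `K`, `T_f = T_pE`, `𝒪₁ = 𝒪_m` a member's coefficient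
ring): `Sel^Σ_𝔮(K, M_f ⊗ 𝒪₁) ≅ 𝒪₁⟦T⟧ ⊗_Λ Sel^Σ_𝔮(K, M_f)`** for `ρ_{E,p} = (W.baseChange K).primaryTorsionGaloisRep p`
(erratum p. 4: the `E`-side lattice `T = T_pE ⊗ 𝒪` of (b), "after possibly enlarging `𝒪`").
[cite: Skinner2016PacificMC, §2.3 (p. 179)] [cite: Castella2018Erratum, proof of Thm. 1.1, (b) (p. 4)] -/
theorem nonempty_selmerBig_primaryTorsion_extendScalars_equiv (h : selmerBig_extendScalars_equiv_baseChange) :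
    Nonempty
      (selmerBig κ (((W.baseChange K).primaryTorsionGaloisRep p).extendScalars 𝒪₁) 𝔮 S ≃ₗ[PowerSeries 𝒪₁]
        PowerSeries 𝒪₁ ⊗[IwasawaAlgebra p] selmerBig κ ((W.baseChange K).primaryTorsionGaloisRep p) 𝔮 S) :=
  h κ ((W.baseChange K).primaryTorsionGaloisRep p) 𝒪₁ 𝔮 S

end Curve

/-! ### Discharge: the fact is a theorem of the tree

Proof (the printed mechanism "`T_{f,1} = T_f ⊗_𝒪 𝒪₁` … hence `Sel_{L₁} ≅ Sel_L ⊗_𝒪 𝒪₁` as a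
`Λ_{𝒪₁} = Λ_𝒪 ⊗_𝒪 𝒪₁`-module", made explicit): choose an `𝒪`-basis `b = (b_i)_{i∈ι}` of `𝒪₁`
(`Module.Free`, finite by `Module.Finite`) and the `𝒪⟦T⟧`-basis `e = (C b_i)` of `𝒪₁⟦T⟧`
(`Literature.RingTheory.PowerSeries.exists_basis_eq_C`). Coordinates along `b` identify the big module
`M₁ = (T ⊗ 𝒪₁) ⊗ Λ_{𝒪₁}^*` with `M^ι`, `Γ_K`-equivariantly, `𝒪⟦T⟧`-linearly, and with `s ∈ 𝒪₁⟦T⟧` acting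
through its regular-representation matrix along `e` (`BigRepModule.coeffCoord`, file
`BigRepModuleCoeffExtension.lean`); continuous `H¹` and the local conditions pass to coordinates
(`cohomologyCoord`, `map_eq_zero_iff_forall_cohomologyCoord`, file `ContinuousH1CoefficientTransport.lean`),
giving `Sel(M₁) ≃ Sel(M)^ι` with the same matrices; a `𝒪₁⟦T⟧`-module with such coordinates is
`𝒪₁⟦T⟧ ⊗_{𝒪⟦T⟧} Sel(M)` (`Literature.LinearAlgebra.BaseChange.linearEquivTensorOfCoords`). -/

section Discharge

universe u

/-- **Selmer groups along a coordinate system of the coefficients (general shape).** For continuous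
representations `ρ` (over `Λ`) on a discrete `M` and `ρ₁` (over a `Λ`-algebra `Λ₁`, free with finite
`Λ`-basis `e`) on a discrete `M₁`, an additive `Γ`-equivariant coordinate system `Θ : M₁ ≃ M^ι` in which
every `s ∈ Λ₁` acts through its regular-representation matrix along `e`, and any family of local maps
`φ_v : Γ_v → Γ` with constrained set `L`: `Sel_L(Γ, M₁) ≃ₗ[Λ₁] Λ₁ ⊗_Λ Sel_L(Γ, M)` (continuous `H¹` and the
local conditions pass to coordinates, `ContinuousH1CoefficientTransport.lean`; recognition of the
extension of scalars by coordinates, `FreeFiniteBaseChangeOfCoordinates.lean`). The mechanism of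
[Skinner2016PacificMC] §2.3 for "`Sel_{L₁} ≅ Sel_L ⊗_𝒪 𝒪₁` as a `Λ_{𝒪₁} = Λ_𝒪 ⊗_𝒪 𝒪₁`-module".
[cite: Skinner2016PacificMC, §2.3 (p. 179)] -/
theorem nonempty_selmer_equiv_tensor_of_coords
    {Λ : Type*} [CommRing Λ] [TopologicalSpace Λ] {Λ₁ : Type*} [CommRing Λ₁] [TopologicalSpace Λ₁]
    [Algebra Λ Λ₁]
    {Γ : Type u} [Group Γ] [TopologicalSpace Γ] [IsTopologicalGroup Γ]
    {κι : Type*} {Γv : κι → Type u} [∀ v, Group (Γv v)] [∀ v, TopologicalSpace (Γv v)]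
    [∀ v, IsTopologicalGroup (Γv v)] (φ : ∀ v, Γv v →ₜ* Γ) (L : Set κι)
    {M : Type u} [AddCommGroup M] [Module Λ M] [TopologicalSpace M] [DiscreteTopology M]
    [ContinuousSMul Λ M]
    {M₁ : Type u} [AddCommGroup M₁] [Module Λ₁ M₁] [TopologicalSpace M₁] [DiscreteTopology M₁]
    [ContinuousSMul Λ₁ M₁]
    (ρ : ContinuousRep Γ Λ M) (ρ₁ : ContinuousRep Γ Λ₁ M₁)
    {ι : Type u} [Fintype ι] [DecidableEq ι] (e : Module.Basis ι Λ Λ₁)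
    (Θ : M₁ ≃+ (ι → M)) (hρ : ∀ (g : Γ) (m : M₁) (i : ι), Θ (ρ₁ g m) i = ρ g (Θ m i))
    (hmat : ∀ (s : Λ₁) (m : M₁) (i : ι), Θ (s • m) i = ∑ j, e.repr (s * e j) i • Θ m j) :
    Nonempty (selmer φ L ρ₁ ≃ₗ[Λ₁] Λ₁ ⊗[Λ] selmer φ L ρ) := by
  -- the coordinate system on the attached topological representations
  have hΘc : Continuous Θ := continuous_of_discreteTopology
  have hΘs : Continuous Θ.symm := continuous_of_discreteTopology
  have hΘρ : ∀ (g : Γ) (m : ρ₁.toTopRep) (i : ι), Θ (ρ₁.toTopRep.ρ g m) i = ρ.toTopRep.ρ g (Θ m i) :=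
    hρ
  -- the Selmer conditions hold coordinatewise
  have hsel : ∀ x : continuousCohomology 1 ρ₁.toTopRep,
      x ∈ selmer φ L ρ₁ ↔ ∀ i, cohomologyCoord (X := ρ.toTopRep) (X₁ := ρ₁.toTopRep) Θ hΘc hΘρ x i ∈ selmer φ L ρ := by
    intro x
    have hv : ∀ v, resH1 ρ₁ (φ v) x = 0 ↔ ∀ i, resH1 ρ (φ v) (cohomologyCoord (X := ρ.toTopRep) (X₁ := ρ₁.toTopRep) Θ hΘc hΘρ x i) = 0 := by
      intro v
      have hσ : ∀ (g : Γv v) (m : (ρ₁.restrict (φ v)).toTopRep) (i : ι),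
          Θ ((ρ₁.restrict (φ v)).toTopRep.ρ g m) i = (ρ.restrict (φ v)).toTopRep.ρ g (Θ m i) :=
        fun g m i ↦ hρ (φ v g) m i
      have hf : ∀ (m : ρ₁.toTopRep) (i : ι),
          Θ ((resMod ρ₁ (φ v)).hom m) i = (resMod ρ (φ v)).hom (Θ m i) := fun m i ↦ by
        rw [resMod_hom_apply, resMod_hom_apply]
      exact map_eq_zero_iff_forall_cohomologyCoord (X := ρ.toTopRep) (X₁ := ρ₁.toTopRep) Θ hΘc hΘρ Θ hΘc hσ hΘs (φ v) (resMod ρ (φ v))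
        (resMod ρ₁ (φ v)) hf x
    simp only [mem_selmer_iff]
    exact ⟨fun h i v hvL ↦ (hv v).1 (h v hvL) i, fun h v hvL ↦ (hv v).2 fun i ↦ h i v hvL⟩
  -- the additive coordinate system of the Selmer group, and its matrices
  let ES : selmer φ L ρ₁ ≃+ (ι → selmer φ L ρ) :=
    { toFun := fun x i ↦ ⟨cohomologyCoord (X := ρ.toTopRep) (X₁ := ρ₁.toTopRep) Θ hΘc hΘρ x.1 i, (hsel x.1).1 x.2 i⟩
      invFun := fun y ↦ ⟨(cohomologyCoordEquiv (X := ρ.toTopRep) (X₁ := ρ₁.toTopRep) Θ hΘc hΘs hΘρ).symm (fun i ↦ (y i).1), by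
        rw [hsel]
        intro i
        have hy : cohomologyCoord (X := ρ.toTopRep) (X₁ := ρ₁.toTopRep) Θ hΘc hΘρ
            ((cohomologyCoordEquiv (X := ρ.toTopRep) (X₁ := ρ₁.toTopRep) Θ hΘc hΘs hΘρ).symm (fun i ↦ (y i).1)) = fun i ↦ (y i).1 :=
          (cohomologyCoordEquiv (X := ρ.toTopRep) (X₁ := ρ₁.toTopRep) Θ hΘc hΘs hΘρ).apply_symm_apply _
        rw [hy]
        exact (y i).2⟩
      left_inv := fun x ↦ Subtype.ext ((cohomologyCoordEquiv (X := ρ.toTopRep) (X₁ := ρ₁.toTopRep) Θ hΘc hΘs hΘρ).symm_apply_apply x.1)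
      right_inv := fun y ↦ funext fun i ↦ Subtype.ext (congrFun
        ((cohomologyCoordEquiv (X := ρ.toTopRep) (X₁ := ρ₁.toTopRep) Θ hΘc hΘs hΘρ).apply_symm_apply (fun i ↦ (y i).1)) i)
      map_add' := fun x y ↦ funext fun i ↦ Subtype.ext (cohomologyCoord_add (X := ρ.toTopRep) (X₁ := ρ₁.toTopRep) Θ hΘc hΘρ x.1 y.1 i) }
  have hES : ∀ (s : Λ₁) (x : selmer φ L ρ₁) (i : ι),
      ES (s • x) i = ∑ j, e.repr (s * e j) i • ES x j := by
    intro s x i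
    apply Subtype.ext
    rw [Submodule.coe_sum]
    simp only [Submodule.coe_smul]
    exact cohomologyCoord_smul_of_matrix (X := ρ.toTopRep) (X₁ := ρ₁.toTopRep) Θ hΘc hΘρ s _ (hmat s) x.1 i
  -- recognition of the extension of scalars by coordinates
  exact ⟨Literature.LinearAlgebra.BaseChange.linearEquivTensorOfCoords e ES hES⟩

/-- **Skinner 2016 §2.3, coefficient base change of `Λ`-adic Selmer groups — PROVED** (discharge of the
named fact `selmerBig_extendScalars_equiv_baseChange`; feed `selmerBig_extendScalars_equiv_baseChange_holds`
to the consumers' `(h : selmerBig_extendScalars_equiv_baseChange)`): with an `𝒪`-basis `b` of `𝒪₁`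
(`Module.Free.chooseBasis`, finite by `Module.Finite`), the `𝒪⟦T⟧`-basis `C ∘ b` of `𝒪₁⟦T⟧`
(`Literature.RingTheory.PowerSeries.exists_basis_eq_C`) and the coordinate system
`BigRepModule.coeffCoord b` of `(T ⊗ 𝒪₁) ⊗ Λ_{𝒪₁}^*` (equivariant: `coeffCoord_bigRep`; matrices:
`coeffCoord_smul_eq_sum`), apply `nonempty_selmer_equiv_tensor_of_coords`.
[cite: Skinner2016PacificMC, §2.3 (p. 179), "canonically isomorphic to `Sel^Σ_{ℚ_∞,L}(f) ⊗_𝒪 𝒪₁` as a `Λ_{𝒪₁} = Λ_𝒪 ⊗_𝒪 𝒪₁`-module"] -/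
theorem selmerBig_extendScalars_equiv_baseChange_holds : selmerBig_extendScalars_equiv_baseChange := by
  intro K _ _ p _ κ 𝒪 _ _ A _ _ _ _ ρ 𝒪₁ _ _ _ _ _ 𝔮 S _ _ _ _
  classical
  obtain ⟨e, he⟩ := Literature.RingTheory.PowerSeries.exists_basis_eq_C (Module.Free.chooseBasis 𝒪 𝒪₁)
  exact nonempty_selmer_equiv_tensor_of_coords (localMap K) (strictSet p 𝔮 S)
    (AnticyclotomicBigGaloisRep κ ρ) (AnticyclotomicBigGaloisRep κ (ρ.extendScalars 𝒪₁)) e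
    (BigRepModule.coeffCoord (Module.Free.chooseBasis 𝒪 𝒪₁))
    (fun g m i ↦ BigRepModule.coeffCoord_bigRep _ κ.toContinuousMonoidHom ρ g m i)
    (fun s m i ↦ BigRepModule.coeffCoord_smul_eq_sum _ e he s m i)

end Discharge

end Literature.NumberTheory.EllipticCurves.Skinner2016

end
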